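import Summits.HodgeConjecture.HodgeConjecture.Theorems.HeckePrymWeilHodgeWeilOfWeilTransport
import Summits.HodgeConjecture.HodgeConjecture.Theorems.HeckePrymWeilAssembly
import Summits.HodgeConjecture.HodgeConjecture.Theorems.HeckePrymWeilWeilDescendingProof
import HarnessLib

/-!
# Crux `WeilTwelvefoldsSqrtMinus7` ⟺ variational Hodge for flat WEIL classes of `√-7`-twelvefold families (modulo M3)

Route `HeckePrymWeil` (sub-problem `HodgeConjecture`); lead seat c5 of crux `WeilTwelvefoldsSqrtMinus7`
(stmt-HodgeConjecture-1261), line `isotypic-unimodular-saturation`, reshape r4 ("Weil transport") — the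
instance `(p, k) = (7, 6)` of `HeckePrymWeilHodgeWeilOfWeilTransport`:

* `weilTwelvefoldsSqrtMinus7_of_weilTransport_of_levelStructure` — the r4 COMPOSITION: crux ⟸ M3
  (`deligne1982_weilFamily_levelStructure`, Deligne's level-`n` abelian scheme with `𝒪_K`-action) + the
  Weil transport `WT(7, 6)` (variational Hodge for global classes fibrewise in the Weil plane of a chart,
  along smooth projective families of `√-7`-abelian twelvefolds over smooth irreducible bases);
* `weilTransport_six_of_weilTwelvefoldsSqrtMinus7` — TIGHTNESS: crux ⟹ `WT(7, 6)`;
* `weilTwelvefoldsSqrtMinus7_iff_weilTransport_of_levelStructure` — modulo M3, crux ⟺ `WT(7, 6)`;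
* `weilTransport_six_of_weilVariationalHodge` — `WT(7, 6) ⟸ WeilVariationalHodge` (stmt-14497);
* `hodgeWeilLadder_iff_weilTransport_of_levelStructure` — the route TARGET `HodgeWeilLadder`
  (stmt-HodgeConjecture-1259) is, modulo M3, EQUIVALENT to the Weil transport `WT(p, k)` at EVERY
  `p ≡ 3 (4)` prime `≥ 7` and `k ≥ 1` (forward through the PROVED support `WeilDescending`,
  `Theorems.weilDescending_proof`, and the ladder descent of the assembly; backward through the r4
  composition): the route's two uniform cruxes `HeckePrymAnchors` + `WeilVariationalHodge` may be replaced
  by the single Weil-restricted transport statement, which is then equivalent to the target.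

So item stmt-HodgeConjecture-1261 is, given the literature construction M3, EXACTLY the statement
"variational Hodge for flat Weil classes of `√-7`-twelvefold families" — an HC-implied instance of
Grothendieck's variational Hodge conjecture; the line reduces nothing further.  CONDITIONAL on the
hypotheses spelled out; no `sorry`, no new definition.
-/

noncomputable section

-- every declaration of this problem lives in `Summit.HodgeConjecture.HodgeConjecture.…` (summit = sub-problem)
set_option linter.dupNamespace false

open CategoryTheory AlgebraicGeometry Limits MonoidalCategory CartesianMonoidalCategory

namespace Summit.HodgeConjecture.HodgeConjecture.Theorems.HeckePrymWeilLine

open Literature.AlgebraicGeometry Literature.AlgebraicGeometry.Motives Literature.AlgebraicGeometry.HodgeTheory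
open Literature.AlgebraicTopology.SingularHomology
open Summit.HodgeConjecture.HodgeConjecture.Theses.HeckePrymWeil

/-! ### The crux `WeilTwelvefoldsSqrtMinus7` at `(p, k) = (7, 6)` -/

/-- **The crux `WeilTwelvefoldsSqrtMinus7` (stmt-HodgeConjecture-1261) from Deligne's level-`n` abelian
scheme (`deligne1982_weilFamily_levelStructure`, M3) and the WEIL transport at `(7, 6)`** — variational
Hodge for global classes fibrewise in the Weil plane of a chart, along smooth projective families of
`√-7`-abelian twelvefolds over smooth irreducible bases (CONDITIONAL result; the line's r4 composition).
[cite: Deligne1982HodgeCycles, proof of Thm. 4.8 (the group Γ, n ≥ 3), Lemma 4.5, Remark 4.10]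
[cite: Grothendieck1966, footnote 13] -/
theorem weilTwelvefoldsSqrtMinus7_of_weilTransport_of_levelStructure
    (hLS : deligne1982_weilFamily_levelStructure)
    (hT : ∀ ⦃𝒳 S : SchemeOver ℂ⦄ (f : 𝒳 ⟶ S), IsSmoothProjectiveFamily f (2 * 6) →
      IrreducibleSpace S.left → AlgebraicGeometry.Smooth S.hom →
      ∀ (W : complexBetti 𝒳 (2 * 6)),
        (∀ s : ComplexPoints S, IsRationalClass (complexBetti.map (fiberι f s) (2 * 6) W) ∧
          IsOfHodgeType (2 * 6) (fiberOver f s) (2 * 6) 6 6 (complexBetti.map (fiberι f s) (2 * 6) W)) →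
        (∀ s : ComplexPoints S, ∃ (A' : AbelianVariety ℂ) (φ' : A' ⟶ A') (e' : A'.X ≅ fiberOver f s),
          A'.dim = 2 * 6 ∧ φ' ≫ φ' = -(((7 : ℕ) : ℤ) • 𝟙 A') ∧
          complexBetti.map e'.hom (2 * 6) (complexBetti.map (fiberι f s) (2 * 6) W) ∈
            weilClassesOf A' φ' 6 7) →
        (∃ s₀ : ComplexPoints S,
          complexBetti.map (fiberι f s₀) (2 * 6) W ∈ algebraicClasses (fiberOver f s₀) 6) →
        ∀ s : ComplexPoints S,
          complexBetti.map (fiberι f s) (2 * 6) W ∈ algebraicClasses (fiberOver f s) 6) :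
    WeilTwelvefoldsSqrtMinus7 := by
  intro A φ hA hφ c hrat hH hW
  exact hodgeWeil_of_weilTransport_of_globalAction
    (deligne1982_weilFamily_globalAction_of_kAction (deligne1982_weilFamily_kAction_of_levelStructure hLS))
    (p := 7) (by norm_num) (by norm_num) le_rfl (k := 6) (by norm_num) hT A φ hA (by exact_mod_cast hφ) c
    hrat hH (by exact_mod_cast hW)

/-- **Tightness at `(7, 6)`: the crux implies the Weil transport at `(7, 6)`** (no family structure
needed). [cite: vanGeemen1994HodgeAV, 4.9] [cite: Fulton1998, §19.1] -/
theorem weilTransport_six_of_weilTwelvefoldsSqrtMinus7 (h : WeilTwelvefoldsSqrtMinus7) :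
    ∀ ⦃𝒳 S : SchemeOver ℂ⦄ (f : 𝒳 ⟶ S), IsSmoothProjectiveFamily f (2 * 6) →
      IrreducibleSpace S.left → AlgebraicGeometry.Smooth S.hom →
      ∀ (W : complexBetti 𝒳 (2 * 6)),
        (∀ s : ComplexPoints S, IsRationalClass (complexBetti.map (fiberι f s) (2 * 6) W) ∧
          IsOfHodgeType (2 * 6) (fiberOver f s) (2 * 6) 6 6 (complexBetti.map (fiberι f s) (2 * 6) W)) →
        (∀ s : ComplexPoints S, ∃ (A' : AbelianVariety ℂ) (φ' : A' ⟶ A') (e' : A'.X ≅ fiberOver f s),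
          A'.dim = 2 * 6 ∧ φ' ≫ φ' = -(((7 : ℕ) : ℤ) • 𝟙 A') ∧
          complexBetti.map e'.hom (2 * 6) (complexBetti.map (fiberι f s) (2 * 6) W) ∈
            weilClassesOf A' φ' 6 7) →
        (∃ s₀ : ComplexPoints S,
          complexBetti.map (fiberι f s₀) (2 * 6) W ∈ algebraicClasses (fiberOver f s₀) 6) →
        ∀ s : ComplexPoints S,
          complexBetti.map (fiberι f s) (2 * 6) W ∈ algebraicClasses (fiberOver f s) 6 := by
  refine weilTransport_of_hodgeWeil (p := 7) (k := 6) fun A φ hA hφ c hrat hH hW ↦ ?_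
  exact h A φ hA (by exact_mod_cast hφ) c hrat hH (by exact_mod_cast hW)

/-- **MODULO M3, the crux `WeilTwelvefoldsSqrtMinus7` is EQUIVALENT to the Weil transport at `(7, 6)`**
— the certificate that the line `isotypic-unimodular-saturation` reduces nothing further: item
stmt-HodgeConjecture-1261 is exactly "variational Hodge for flat Weil classes of `√-7`-twelvefold
families", an instance of `WeilVariationalHodge` (stmt-HodgeConjecture-14497,
`weilTransport_of_transport`). [cite: Deligne1982HodgeCycles, proof of Thm. 4.8]
[cite: Grothendieck1966, footnote 13] -/
theorem weilTwelvefoldsSqrtMinus7_iff_weilTransport_of_levelStructure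
    (hLS : deligne1982_weilFamily_levelStructure) :
    WeilTwelvefoldsSqrtMinus7 ↔
    (∀ ⦃𝒳 S : SchemeOver ℂ⦄ (f : 𝒳 ⟶ S), IsSmoothProjectiveFamily f (2 * 6) →
      IrreducibleSpace S.left → AlgebraicGeometry.Smooth S.hom →
      ∀ (W : complexBetti 𝒳 (2 * 6)),
        (∀ s : ComplexPoints S, IsRationalClass (complexBetti.map (fiberι f s) (2 * 6) W) ∧
          IsOfHodgeType (2 * 6) (fiberOver f s) (2 * 6) 6 6 (complexBetti.map (fiberι f s) (2 * 6) W)) →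
        (∀ s : ComplexPoints S, ∃ (A' : AbelianVariety ℂ) (φ' : A' ⟶ A') (e' : A'.X ≅ fiberOver f s),
          A'.dim = 2 * 6 ∧ φ' ≫ φ' = -(((7 : ℕ) : ℤ) • 𝟙 A') ∧
          complexBetti.map e'.hom (2 * 6) (complexBetti.map (fiberι f s) (2 * 6) W) ∈
            weilClassesOf A' φ' 6 7) →
        (∃ s₀ : ComplexPoints S,
          complexBetti.map (fiberι f s₀) (2 * 6) W ∈ algebraicClasses (fiberOver f s₀) 6) →
        ∀ s : ComplexPoints S,
          complexBetti.map (fiberι f s) (2 * 6) W ∈ algebraicClasses (fiberOver f s) 6) :=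
  ⟨weilTransport_six_of_weilTwelvefoldsSqrtMinus7,
    weilTwelvefoldsSqrtMinus7_of_weilTransport_of_levelStructure hLS⟩

/-- **The Weil transport at `(7, 6)` from `WeilVariationalHodge`** (stmt-HodgeConjecture-14497 at
`p = 7`, `M = 6`): the line's C⁺ is an instance of the route's transport crux.
[cite: Grothendieck1966, footnote 13] [cite: CharlesSchnell2014Notes, Conj. 11.3.1] -/
theorem weilTransport_six_of_weilVariationalHodge (hV : WeilVariationalHodge) :
    ∀ ⦃𝒳 S : SchemeOver ℂ⦄ (f : 𝒳 ⟶ S), IsSmoothProjectiveFamily f (2 * 6) →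
      IrreducibleSpace S.left → AlgebraicGeometry.Smooth S.hom →
      ∀ (W : complexBetti 𝒳 (2 * 6)),
        (∀ s : ComplexPoints S, IsRationalClass (complexBetti.map (fiberι f s) (2 * 6) W) ∧
          IsOfHodgeType (2 * 6) (fiberOver f s) (2 * 6) 6 6 (complexBetti.map (fiberι f s) (2 * 6) W)) →
        (∀ s : ComplexPoints S, ∃ (A' : AbelianVariety ℂ) (φ' : A' ⟶ A') (e' : A'.X ≅ fiberOver f s),
          A'.dim = 2 * 6 ∧ φ' ≫ φ' = -(((7 : ℕ) : ℤ) • 𝟙 A') ∧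
          complexBetti.map e'.hom (2 * 6) (complexBetti.map (fiberι f s) (2 * 6) W) ∈
            weilClassesOf A' φ' 6 7) →
        (∃ s₀ : ComplexPoints S,
          complexBetti.map (fiberι f s₀) (2 * 6) W ∈ algebraicClasses (fiberOver f s₀) 6) →
        ∀ s : ComplexPoints S,
          complexBetti.map (fiberι f s) (2 * 6) W ∈ algebraicClasses (fiberOver f s) 6 :=
  weilTransport_of_transport (hV 7 (by norm_num) (by norm_num) le_rfl 6 (by norm_num))

/-! ### The route target: `HodgeWeilLadder` ⟺ Weil transport at every `(p, k)` (modulo M3) -/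

/-- **MODULO M3, the route TARGET `HodgeWeilLadder` (stmt-HodgeConjecture-1259) is EQUIVALENT to the Weil
transport `WT(p, k)` for every prime `p ≡ 3 (4)`, `p ≥ 7`, and every `k ≥ 1`.**  Forward: the ladder and
the PROVED support `WeilDescending` (`Theorems.weilDescending_proof`) give `HWA(p, k)` for every `k ≥ 1`
(`heckePrymWeil_ladder_descent` with step `(p-1)/2`), whence `WT(p, k)` by tightness
(`weilTransport_of_hodgeWeil`) — this direction does not use M3.  Backward: `WT(p, k)` for all `k` gives
`HWA(p, k)` for all `k` (`hodgeWeil_of_weilTransport_of_globalAction`, M3 ⟹ global action), in particular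
the rungs `k = (p-1)/2 · (g-1) ≥ 3`. [cite: Deligne1982HodgeCycles, proof of Thm. 4.8]
[cite: Grothendieck1966, footnote 13] [cite: vanGeemen1994HodgeAV, 4.9] -/
theorem hodgeWeilLadder_iff_weilTransport_of_levelStructure
    (hLS : deligne1982_weilFamily_levelStructure) :
    HodgeWeilLadder ↔
    (∀ p : ℕ, p.Prime → p % 4 = 3 → 7 ≤ p → ∀ k : ℕ, 1 ≤ k →
      ∀ ⦃𝒳 S : SchemeOver ℂ⦄ (f : 𝒳 ⟶ S), IsSmoothProjectiveFamily f (2 * k) →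
      IrreducibleSpace S.left → AlgebraicGeometry.Smooth S.hom →
      ∀ (W : complexBetti 𝒳 (2 * k)),
        (∀ s : ComplexPoints S, IsRationalClass (complexBetti.map (fiberι f s) (2 * k) W) ∧
          IsOfHodgeType (2 * k) (fiberOver f s) (2 * k) k k (complexBetti.map (fiberι f s) (2 * k) W)) →
        (∀ s : ComplexPoints S, ∃ (A' : AbelianVariety ℂ) (φ' : A' ⟶ A') (e' : A'.X ≅ fiberOver f s),
          A'.dim = 2 * k ∧ φ' ≫ φ' = -((p : ℤ) • 𝟙 A') ∧
          complexBetti.map e'.hom (2 * k) (complexBetti.map (fiberι f s) (2 * k) W) ∈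
            weilClassesOf A' φ' k p) →
        (∃ s₀ : ComplexPoints S,
          complexBetti.map (fiberι f s₀) (2 * k) W ∈ algebraicClasses (fiberOver f s₀) k) →
        ∀ s : ComplexPoints S,
          complexBetti.map (fiberι f s) (2 * k) W ∈ algebraicClasses (fiberOver f s) k) := by
  constructor
  · intro hL p hp hp4 hp7 k hk
    refine weilTransport_of_hodgeWeil (p := p) (k := k) ?_
    -- `HWA(p, k)` for every `k ≥ 1` from the ladder and the proved `WeilDescending`
    exact Theorems.heckePrymWeil_ladder_descent
      (fun n ↦ ∀ (A : AbelianVariety ℂ) (φ : A ⟶ A), A.dim = 2 * n → φ ≫ φ = -((p : ℤ) • 𝟙 A) →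
        ∀ c : complexBetti A.X (2 * n), IsRationalClass c → IsOfHodgeType (2 * n) A.X (2 * n) n n c →
          c ∈ Module.End.eigenspace (complexBetti.map (𝟙 A + φ).hom.hom.hom (2 * n)).hom
                ((1 + Complex.I * (Real.sqrt (p : ℝ) : ℂ)) ^ (2 * n)) ⊔
              Module.End.eigenspace (complexBetti.map (𝟙 A + φ).hom.hom.hom (2 * n)).hom
                ((1 - Complex.I * (Real.sqrt (p : ℝ) : ℂ)) ^ (2 * n)) →
          c ∈ algebraicClasses A.X n)
      ((p - 1) / 2) (by omega) (hL p hp hp4 hp7) (Theorems.weilDescending_proof p hp hp4 hp7) k hk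
  · intro hT p hp hp4 hp7 g hg n hn A φ hA hφ c hrat hH hW
    have hn1 : 1 ≤ n := by have := owf_three_le_k hp7 hg hn; omega
    exact hodgeWeil_of_weilTransport_of_globalAction
      (deligne1982_weilFamily_globalAction_of_kAction (deligne1982_weilFamily_kAction_of_levelStructure hLS))
      hp hp4 hp7 hn1 (hT p hp hp4 hp7 n hn1) A φ hA hφ c hrat hH hW

end Summit.HodgeConjecture.HodgeConjecture.Theorems.HeckePrymWeilLine

end
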